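import Literature.AlgebraicGeometry.Surfaces.ShiodaInoseSingularK3
import Literature.AlgebraicGeometry.Surfaces.K3MarkingProofs
import Literature.Topology.FourManifolds.LatticeFormsEichlerTransitivity
import HarnessLib

/-!
# Uniqueness of primitive embeddings of rank-two lattices into the K3 lattice — proof
# (Huybrechts, *Lectures on K3 Surfaces*, Ch. 14 Prop. 1.8, Cor. 1.9; James 1968; Nikulin 1.14.4)

Second "Proofs" sibling (D-0026: theorems only, no new named fact) of `ShiodaInoseSingularK3.lean`
(the first, `ShiodaInoseSingularK3Proofs.lean`, treats the Shioda–Inose fact): discharges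
`Nikulin1980_k3Lattice_primitiveEmbedding_rankTwo_unique` (Huybrechts Ch. 14 Cor. 1.9 for
`Λ = Λ_{K3} = E₈(−1)^{⊕2} ⊕ U^{⊕3}`, `rk Λ₁ = 2 < 3`; = Nikulin Thm. 1.14.4; held text PDF p. 339:
"For the uniqueness, see [278]" = D. G. James, *On Witt's theorem for unimodular quadratic
forms*, Pacific J. Math. 26 (1968)).

**Proof followed** (James/Wall: Witt's theorem over `ℤ` by Eichler transvections when the rank
of the sublattice is less than the number of hyperbolic planes; the tree vendors this machinery
from GHS 2009 §3 in `LatticeFormsEichlerCriterion.lean`, `LatticeFormsEichlerTransitivity.lean`).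
Write `U^{⊕3} = ⟨p, q⟩ ⊕ ⟨x, y⟩ ⊕ ⟨x₁, y₁⟩ ⊂ Λ`. Every pair `(t₁, t₂)` with Gram matrix
`((2a, b), (b, 2c))` spanning a primitive sublattice is carried by an isometry of `Λ` to the
**Looijenga–Peters normal form** `(p + a q, b q + x₁ + c y₁)` (the embedding
`aᵢ ↦ eᵢ + ½(aᵢ.aᵢ) fᵢ + Σ_{j<i} (aⱼ.aᵢ) fⱼ` of Huybrechts Ch. 14 Prop. 1.8, proof), so two such
pairs differ by an isometry: (i) primitivity + unimodularity give dual vectors `s₁, s₂`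
(`t₁.s₁ = 1`, `t₁.s₂ = 0`, `t₂.s₂ = 1`; `exists_dual_witnesses`); (ii) GHS Lemma 3.2
(`exists_uGens_ortho`) moves `t₁` into `⟨x, y⟩^⊥` and the three-transvection translation of
Prop. 3.3 (i) (`eichler_translation`) moves it onto `p + a q`; (iii) the same two steps, run with
transvections `E(x, ·)`, `E(y, ·)` whose vectors are orthogonal to `p + a q` (this is where the
third hyperbolic pair is needed), fix `p + a q` and move `t₂` onto `b q + x₁ + c y₁`; (iv) words
act by bundled isometries (`UGen.evalEquiv`), and `Φ⁻¹ ∘ Φ'` becomes an integral matrix `g` with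
`gᵀ Λ g = Λ` (`LinearMap.toMatrix'`). The hypotheses `0 < a`, `0 < c` of the fact are not used;
`b² < 4ac` only gives `4ac − b² ≠ 0` (independence of `t₁, t₂`).

## References

* [Huybrechts2016K3] D. Huybrechts, Lectures on K3 Surfaces, CUP 2016, Ch. 14 Prop. 1.8 (proof),
  Cor. 1.9, Thm. 1.12 (PDF pp. 339–340).
* [Nikulin1980] V. V. Nikulin, Integral symmetric bilinear forms and some of their applications,
  Math. USSR Izv. 14 (1980) 103–167, Thm. 1.14.4 (not held; cited through Huybrechts).
* [GritsenkoHulekSankaran2009] V. Gritsenko, K. Hulek, G. K. Sankaran, J. Algebra 322 (2009),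
  §3, Lemma 3.2 and Prop. 3.3 (i) (the Eichler-transvection machinery vendored in the tree).
-/
noncomputable section

open Module Matrix
open LinearMap (BilinForm)
open Literature.Topology.FourManifolds

namespace Literature.AlgebraicGeometry.Surfaces

/-! ### Abstract part: a symmetric even integral form with three orthogonal hyperbolic pairs -/
section Abstract

variable {W : Type*} [AddCommGroup W] {B : BilinForm ℤ W} {x y x₁ y₁ : W}

/-- A word all of whose letters fix `v` fixes `v`. [folklore] -/
theorem uGen_eval_apply_of_forall {l : List (UGen W)} {v : W}
    (hl : ∀ g ∈ l, g.toLinearMap B x y v = v) : UGen.eval B x y l v = v := by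
  induction l with
  | nil => rfl
  | cons g l ih =>
    rw [UGen.eval_cons, LinearMap.comp_apply, ih fun g' hg' => hl g' (List.mem_cons_of_mem g hg'),
      hl g List.mem_cons_self]

/-- **GHS Lemma 3.2 with its fixed vectors**: the admissible word of `exists_uGens_ortho` moving
`u` into `⟨x, y⟩^⊥` consists of the families `E(x, c x₁)`, `E(y, c y₁)`, `E(x, c y₁)`, `E(y, c x₁)`,
hence fixes `⟨x, y, x₁, y₁⟩^⊥` pointwise. [cite: GritsenkoHulekSankaran2009, Lemma 3.2] -/
theorem exists_uGens_ortho_fixing (h : TwoHyperbolicPairs B x y x₁ y₁) (u : W) :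
    ∃ l : List (UGen W), (∀ g ∈ l, g.IsAdmissible B x y) ∧
      B x (UGen.eval B x y l u) = 0 ∧ B y (UGen.eval B x y l u) = 0 ∧
      ∀ v, B x v = 0 → B y v = 0 → B x₁ v = 0 → B y₁ v = 0 → UGen.eval B x y l v = v := by
  obtain ⟨L, L', D, hD⟩ :=
    Literature.LinearAlgebra.Matrix.exists_list_transvec_mul_mul_list_transvec_eq_diagonal_int
      (ghsMatrix B x y x₁ y₁ u)
  have hX : ghsMatrix B x y x₁ y₁ (UGen.eval B x y
      ((L'.map (colGen x₁ y₁)).reverse ++ L.map (rowGen x₁ y₁)) u) = diagonal D := by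
    rw [UGen.eval_append, LinearMap.comp_apply, ghsMatrix_eval_reverse_map_colGen h,
      ghsMatrix_eval_map_rowGen h, hD]
  refine ⟨(L'.map (colGen x₁ y₁)).reverse ++ L.map (rowGen x₁ y₁), fun g hg => ?_, ?_, ?_, ?_⟩
  · simp only [List.mem_append, List.mem_reverse, List.mem_map] at hg
    rcases hg with ⟨t, -, rfl⟩ | ⟨t, -, rfl⟩
    · exact isAdmissible_colGen h t
    · exact isAdmissible_rowGen h t
  · simpa using congrFun (congrFun hX 1) 0
  · simpa using congrFun (congrFun hX 0) 1
  · intro v hxv hyv hx₁v hy₁v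
    refine uGen_eval_apply_of_forall fun g hg => ?_
    simp only [List.mem_append, List.mem_reverse, List.mem_map] at hg
    rcases hg with ⟨t, -, rfl⟩ | ⟨t, -, rfl⟩
    · unfold colGen; split_ifs <;> simp [UGen.toLinearMap, hxv, hyv, hx₁v, hy₁v]
    · unfold rowGen; split_ifs <;> simp [UGen.toLinearMap, hxv, hyv, hx₁v, hy₁v]

/-- **Dual vectors in a unimodular lattice**: if every `d` with `u ∈ d W` is a unit, then
`u.s = 1` for some `s` (the values `u.v` form the ideal `dℤ` and `u ∈ d W` by unimodularity;
Serre's indivisible vectors, `exists_eq_smul_of_forall_dvd`). [folklore] -/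
theorem exists_apply_eq_one_of_forall_isUnit [B.IsPerfPair] {u : W}
    (hu : ∀ (d : ℤ) (v : W), u = d • v → IsUnit d) : ∃ s : W, B u s = 1 := by
  set L : Submodule ℤ ℤ := LinearMap.range (B u)
  haveI : L.IsPrincipal := IsPrincipalIdealRing.principal L
  set d : ℤ := Submodule.IsPrincipal.generator L
  have hspan : Submodule.span ℤ {d} = L := Submodule.IsPrincipal.span_singleton_generator L
  have hdvd : ∀ v, d ∣ B u v := fun v => by
    have hv : B u v ∈ Submodule.span ℤ {d} := hspan ▸ LinearMap.mem_range_self (B u) v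
    obtain ⟨k, hk⟩ := Submodule.mem_span_singleton.mp hv
    exact ⟨k, by rw [← hk, smul_eq_mul, mul_comm]⟩
  obtain ⟨u', hu'⟩ := LinearMap.BilinForm.exists_eq_smul_of_forall_dvd hdvd
  obtain ⟨s, hs⟩ := LinearMap.mem_range.mp (Submodule.IsPrincipal.generator_mem L)
  refine ⟨d • s, ?_⟩
  rw [LinearMap.BilinForm.smul_right, hs]
  exact Int.isUnit_mul_self (hu d u' hu')

/-- **Primitivity gives dual witnesses.** For independent `t₁, t₂` spanning a primitive sublattice
(`n v ∈ ℤt₁ + ℤt₂`, `n ≠ 0` ⟹ `v ∈ ℤt₁ + ℤt₂`; Huybrechts Ch. 14 §0.2) of a unimodular lattice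
there are `s₁, s₂` with `t₁.s₁ = 1`, `t₁.s₂ = 0`, `t₂.s₂ = 1`.
[cite: Huybrechts2016K3, Ch. 14 §0.2] -/
theorem exists_dual_witnesses [B.IsPerfPair] {t₁ t₂ : W}
    (hind : ∀ m n : ℤ, m • t₁ + n • t₂ = 0 → m = 0 ∧ n = 0)
    (hprim : ∀ (v : W) (n : ℤ), n ≠ 0 → (∃ m₁ m₂ : ℤ, n • v = m₁ • t₁ + m₂ • t₂) →
      ∃ m₁ m₂ : ℤ, v = m₁ • t₁ + m₂ • t₂) :
    ∃ s₁ s₂ : W, B t₁ s₁ = 1 ∧ B t₁ s₂ = 0 ∧ B t₂ s₂ = 1 := by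
  -- `s₁`
  obtain ⟨s₁, hs₁⟩ : ∃ s₁, B t₁ s₁ = 1 := by
    refine exists_apply_eq_one_of_forall_isUnit fun d v hdv => ?_
    have hd0 : d ≠ 0 := by
      rintro rfl
      rw [zero_smul] at hdv
      have := (hind 1 0 (by rw [hdv, smul_zero, zero_smul, add_zero])).1
      exact one_ne_zero this
    obtain ⟨m₁, m₂, hv⟩ := hprim v d hd0 ⟨1, 0, by rw [← hdv, one_smul, zero_smul, add_zero]⟩
    have hrel : (d * m₁ - 1) • t₁ + (d * m₂) • t₂ = 0 := by
      rw [hv, smul_add, smul_smul, smul_smul] at hdv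
      rw [sub_smul, one_smul, show (d * m₁) • t₁ - t₁ + (d * m₂) • t₂ =
        ((d * m₁) • t₁ + (d * m₂) • t₂) - t₁ by abel, ← hdv, sub_self]
    exact IsUnit.of_mul_eq_one m₁ (by linarith [(hind _ _ hrel).1])
  -- `s₂`, through a dual vector of `t₂ - (t₂.s₁) t₁`
  set k : ℤ := B t₂ s₁ with hk
  obtain ⟨s, hs⟩ : ∃ s, B (t₂ - k • t₁) s = 1 := by
    refine exists_apply_eq_one_of_forall_isUnit fun d v hdv => ?_
    have hd0 : d ≠ 0 := by
      rintro rfl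
      rw [zero_smul, sub_eq_zero] at hdv
      have := (hind (-k) 1 (by rw [hdv, one_smul, neg_smul, neg_add_cancel])).2
      exact one_ne_zero this
    obtain ⟨m₁, m₂, hv⟩ := hprim v d hd0 ⟨-k, 1, by rw [← hdv, neg_smul, one_smul]; abel⟩
    have hrel : (d * m₁ + k) • t₁ + (d * m₂ - 1) • t₂ = 0 := by
      rw [hv, smul_add, smul_smul, smul_smul] at hdv
      rw [add_smul, sub_smul, one_smul, show (d * m₁) • t₁ + k • t₁ + ((d * m₂) • t₂ - t₂) =
        ((d * m₁) • t₁ + (d * m₂) • t₂) + k • t₁ - t₂ by abel, ← hdv]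
      abel
    exact IsUnit.of_mul_eq_one m₂ (by linarith [(hind _ _ hrel).2])
  refine ⟨s₁, s - B t₁ s • s₁, hs₁, ?_, ?_⟩
  · rw [map_sub, LinearMap.BilinForm.smul_right, hs₁, mul_one, sub_self]
  · rw [map_sub, LinearMap.BilinForm.smul_right, ← hk]
    rw [map_sub, LinearMap.sub_apply, LinearMap.BilinForm.smul_left] at hs
    linear_combination hs

/-- **Step 1 of the normal form**: a vector `t` of square `2a` with a dual vector (`t.s = 1`) is
carried by an admissible word in the transvections based at `⟨x, y⟩` to `p + a q`, `(p, q)` a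
hyperbolic pair `⊥ ⟨x, y⟩` (GHS Lemma 3.2, then the translation of the proof of Prop. 3.3 (i)).
[cite: GritsenkoHulekSankaran2009, Lemma 3.2 and Prop. 3.3 (i) (proof)] -/
theorem exists_uGens_apply_eq_normalForm₁ (h : TwoHyperbolicPairs B x y x₁ y₁) (hev : B.IsEven)
    {p q : W} (hpp : B p p = 0) (hqq : B q q = 0) (hpq : B p q = 1) (hpx : B p x = 0)
    (hpy : B p y = 0) (hqx : B q x = 0) (hqy : B q y = 0) (a : ℤ) {t s : W}
    (htt : B t t = 2 * a) (hts : B t s = 1) :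
    ∃ l : List (UGen W), (∀ g ∈ l, g.IsAdmissible B x y) ∧ UGen.eval B x y l t = p + a • q := by
  have hB := h.isSymm
  have hyp : B y p = 0 := by rw [hB.eq, hpy]
  have hyq : B y q = 0 := by rw [hB.eq, hqy]
  have hxp : B x p = 0 := by rw [hB.eq, hpx]
  have hxq : B x q = 0 := by rw [hB.eq, hqx]
  have hqp : B q p = 1 := by rw [hB.eq, hpq]
  -- (1) move `t` into `⟨x, y⟩^⊥`, with a dual vector there
  obtain ⟨l₁, hl₁, hxu, hyu⟩ := exists_uGens_ortho h t
  set u := UGen.eval B x y l₁ t with huE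
  obtain ⟨hxu', hyu', huu'⟩ := exists_dual_ortho h (z := UGen.eval B x y l₁ s) hxu hyu
  rw [UGen.map_eval hB h.xx h.yy hl₁, hts] at huu'
  set u' := UGen.eval B x y l₁ s - B y (UGen.eval B x y l₁ s) • x - B x (UGen.eval B x y l₁ s) • y
  -- (2) the target `p + a q` (dual vector `q`), both orthogonal to `y`; translate
  have hyv : B y (p + a • q) = 0 := by simp [hyp, hyq]
  have hvv : B (p + a • q) (p + a • q) = 2 * a := by
    simp only [map_add, map_smul, LinearMap.add_apply, LinearMap.smul_apply, smul_eq_mul, hpp,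
      hqq, hpq, hqp]
    ring
  have hvq : B (p + a • q) q = 1 := by simp [hpq, hqq]
  have huu : B u u = B (p + a • q) (p + a • q) := by
    rw [hvv, huE, UGen.map_eval hB h.xx h.yy hl₁, htt]
  have hyw : B y (u - (p + a • q)) = 0 := by rw [map_sub, hyu, hyv, sub_zero]
  have hxw : B x (u - (p + a • q)) = 0 := by
    rw [map_sub, hxu, zero_sub, neg_eq_zero]; simp [hxp, hxq]
  obtain ⟨q₁, hq₁⟩ := hev u'
  obtain ⟨q₂, hq₂⟩ := hev (u - (p + a • q))
  have key := eichler_translation (q₁ := q₁) (q₃ := 0) hB h.yy h.xy one_ne_zero hxu hyu hyv hyw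
    hyq (one_smul ℤ (u - (p + a • q))) huu huu' hvq hq₂
  refine ⟨[UGen.atY (-q) 0, UGen.atX (u - (p + a • q)) q₂, UGen.atY u' q₁] ++ l₁, ?_, ?_⟩
  · intro g hg
    simp only [List.mem_append, List.mem_cons, List.not_mem_nil, or_false] at hg
    rcases hg with (rfl | rfl | rfl) | hg
    · exact ⟨by simp [hxq], by simp [hyq], by simp [hqq]⟩
    · exact ⟨hxw, hyw, hq₂⟩
    · exact ⟨hxu', hyu', hq₁⟩
    · exact hl₁ g hg
  · rw [UGen.eval_append, LinearMap.comp_apply, ← huE]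
    exact key

/-- **Step 2 of the normal form**: with `c₁ = p + a q` in place, a vector `t` with `c₁.t = b`,
`t.t = 2c` and a dual vector `s ⊥ c₁` (`t.s = 1`) is carried to `b q + x₁ + c y₁` by an admissible
word FIXING `c₁`: the word of GHS Lemma 3.2 has vectors in `⟨x₁, y₁⟩ ⊥ c₁`, and the translating
transvections have vectors `u' ⊥ c₁`, `u − (b q + x₁ + c y₁) ⊥ c₁` (as `c₁.u = b`) and `−y₁ ⊥ c₁`
— the third hyperbolic pair is the "strict inequality" `2 < 3` of Huybrechts Ch. 14 Cor. 1.9.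
[cite: GritsenkoHulekSankaran2009, Prop. 3.3 (i) (proof)] -/
theorem exists_uGens_apply_eq_normalForm₂ (h : TwoHyperbolicPairs B x y x₁ y₁) (hev : B.IsEven)
    {p q : W} (hqq : B q q = 0) (hpq : B p q = 1) (hpx : B p x = 0) (hpy : B p y = 0)
    (hqx : B q x = 0) (hqy : B q y = 0) (hpx₁ : B p x₁ = 0) (hpy₁ : B p y₁ = 0)
    (hqx₁ : B q x₁ = 0) (hqy₁ : B q y₁ = 0) (a b c : ℤ) {t s : W} (hct : B (p + a • q) t = b)
    (htt : B t t = 2 * c) (hcs : B (p + a • q) s = 0) (hts : B t s = 1) :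
    ∃ l : List (UGen W), (∀ g ∈ l, g.IsAdmissible B x y) ∧
      UGen.eval B x y l (p + a • q) = p + a • q ∧
      UGen.eval B x y l t = b • q + x₁ + c • y₁ := by
  have hB := h.isSymm
  have hyp : B y p = 0 := by rw [hB.eq, hpy]
  have hyq : B y q = 0 := by rw [hB.eq, hqy]
  have hxq : B x q = 0 := by rw [hB.eq, hqx]
  -- `c₁ = p + a q` is orthogonal to `x, y, x₁, y₁`
  have hxc : B x (p + a • q) = 0 := by rw [hB.eq]; simp [hpx, hqx]
  have hyc : B y (p + a • q) = 0 := by simp [hyp, hyq]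
  have hx₁c : B x₁ (p + a • q) = 0 := by rw [hB.eq]; simp [hpx₁, hqx₁]
  have hy₁c : B y₁ (p + a • q) = 0 := by rw [hB.eq]; simp [hpy₁, hqy₁]
  -- (1) move `t` into `⟨x, y⟩^⊥` by a word fixing `c₁`, with a dual vector `u' ⊥ c₁` there
  obtain ⟨l₁, hl₁, hxu, hyu, hfix⟩ := exists_uGens_ortho_fixing h t
  have hc₁ : UGen.eval B x y l₁ (p + a • q) = p + a • q := hfix _ hxc hyc hx₁c hy₁c
  set u := UGen.eval B x y l₁ t with huE
  set z := UGen.eval B x y l₁ s with hzE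
  obtain ⟨hxu', hyu', huu'⟩ := exists_dual_ortho h (z := z) hxu hyu
  rw [hzE, UGen.map_eval hB h.xx h.yy hl₁, hts] at huu'
  set u' := z - B y z • x - B x z • y with hu'E
  have hcz : B (p + a • q) z = 0 := by
    rw [hzE, ← hc₁, UGen.map_eval hB h.xx h.yy hl₁, hcs]
  have hcu : B (p + a • q) u = b := by
    rw [huE, ← hc₁, UGen.map_eval hB h.xx h.yy hl₁, hct]
  have hcu' : B (p + a • q) u' = 0 := by
    have hcx : B (p + a • q) x = 0 := by rw [hB.eq, hxc]
    have hcy : B (p + a • q) y = 0 := by rw [hB.eq, hyc]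
    rw [hu'E, map_sub, map_sub, LinearMap.BilinForm.smul_right, LinearMap.BilinForm.smul_right,
      hcz, hcx, hcy, mul_zero, mul_zero, sub_zero, sub_zero]
  -- (2) the target `v = b q + x₁ + c y₁` (dual vector `y₁`), orthogonal to `y`; `c₁ ⊥ u - v`
  set v := b • q + x₁ + c • y₁ with hvE
  have hyv : B y v = 0 := by simp [hvE, hyq, h.yx₁, h.yy₁]
  have hxv : B x v = 0 := by simp [hvE, hxq, h.xx₁, h.xy₁]
  have hvv : B v v = 2 * c := by
    have hx₁q : B x₁ q = 0 := by rw [hB.eq, hqx₁]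
    have hy₁q : B y₁ q = 0 := by rw [hB.eq, hqy₁]
    simp only [hvE, map_add, map_smul, LinearMap.add_apply, LinearMap.smul_apply, smul_eq_mul,
      hqq, hqx₁, hqy₁, hx₁q, hy₁q, h.x₁x₁, h.x₁y₁, h.y₁x₁, h.y₁y₁]
    ring
  have hvy₁ : B v y₁ = 1 := by simp [hvE, hqy₁, h.x₁y₁, h.y₁y₁]
  have hcv : B (p + a • q) v = b := by
    simp only [hvE, map_add, map_smul, LinearMap.add_apply, LinearMap.smul_apply, smul_eq_mul,
      hpq, hqq, hpx₁, hqx₁, hpy₁, hqy₁]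
    ring
  have huu : B u u = B v v := by rw [hvv, huE, UGen.map_eval hB h.xx h.yy hl₁, htt]
  have hyw : B y (u - v) = 0 := by rw [map_sub, hyu, hyv, sub_zero]
  have hxw : B x (u - v) = 0 := by rw [map_sub, hxu, hxv, sub_zero]
  have hcw : B (p + a • q) (u - v) = 0 := by rw [map_sub, hcu, hcv, sub_self]
  obtain ⟨q₁, hq₁⟩ := hev u'
  obtain ⟨q₂, hq₂⟩ := hev (u - v)
  have key := eichler_translation (q₁ := q₁) (q₃ := 0) hB h.yy h.xy one_ne_zero hxu hyu hyv hyw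
    h.yy₁ (one_smul ℤ (u - v)) huu huu' hvy₁ hq₂
  -- (3) the three translating transvections fix `c₁`
  have e₁ : B.eichlerTransvection y u' q₁ (p + a • q) = p + a • q := by
    have : B u' (p + a • q) = 0 := by rw [hB.eq, hcu']
    rw [LinearMap.BilinForm.eichlerTransvection_apply, hyc, this]; simp
  have e₂ : B.eichlerTransvection x (u - v) q₂ (p + a • q) = p + a • q := by
    have : B (u - v) (p + a • q) = 0 := by rw [hB.eq, hcw]
    rw [LinearMap.BilinForm.eichlerTransvection_apply, hxc, this]; simp
  have e₃ : B.eichlerTransvection y (-y₁) 0 (p + a • q) = p + a • q := by simp [hyc, hy₁c]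
  refine ⟨[UGen.atY (-y₁) 0, UGen.atX (u - v) q₂, UGen.atY u' q₁] ++ l₁, ?_, ?_, ?_⟩
  · intro g hg
    simp only [List.mem_append, List.mem_cons, List.not_mem_nil, or_false] at hg
    rcases hg with (rfl | rfl | rfl) | hg
    · exact ⟨by simp [h.xy₁], by simp [h.yy₁], by simp [h.y₁y₁]⟩
    · exact ⟨hxw, hyw, hq₂⟩
    · exact ⟨hxu', hyu', hq₁⟩
    · exact hl₁ g hg
  · rw [UGen.eval_append, LinearMap.comp_apply, hc₁]
    change B.eichlerTransvection y (-y₁) 0 (B.eichlerTransvection x (u - v) q₂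
      (B.eichlerTransvection y u' q₁ (p + a • q))) = p + a • q
    rw [e₁, e₂, e₃]
  · rw [UGen.eval_append, LinearMap.comp_apply, ← huE]
    exact key

/-- Vectors with Gram matrix `((2a, b), (b, 2c))`, `b² < 4ac`, are linearly independent.
[folklore] -/
theorem eq_zero_of_gram {t₁ t₂ : W} {a b c : ℤ} (h11 : B t₁ t₁ = 2 * a) (h12 : B t₁ t₂ = b)
    (h21 : B t₂ t₁ = b) (h22 : B t₂ t₂ = 2 * c) (hdisc : b * b < 4 * a * c) (m n : ℤ)
    (hmn : m • t₁ + n • t₂ = 0) : m = 0 ∧ n = 0 := by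
  have e1 : m * (2 * a) + n * b = 0 := by simpa [h11, h12] using congrArg (B t₁) hmn
  have e2 : m * b + n * (2 * c) = 0 := by simpa [h21, h22] using congrArg (B t₂) hmn
  have hD : 4 * a * c - b * b ≠ 0 := by intro h0; linarith
  have hn : (4 * a * c - b * b) * n = 0 := by linear_combination 2 * a * e2 - b * e1
  have hm : (4 * a * c - b * b) * m = 0 := by linear_combination 2 * c * e1 - b * e2
  exact ⟨(mul_eq_zero.mp hm).resolve_left hD, (mul_eq_zero.mp hn).resolve_left hD⟩

/-- **Normal form** (three hyperbolic pairs, unimodular, even): a pair `(t₁, t₂)` with Gram matrix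
`((2a, b), (b, 2c))`, `b² < 4ac`, spanning a primitive sublattice is carried by an isometry onto
the Looijenga–Peters pair `(p + a q, b q + x₁ + c y₁)` (Huybrechts Ch. 14 Prop. 1.8, proof;
uniqueness Cor. 1.9 after James). [cite: Huybrechts2016K3, Ch. 14 Prop. 1.8 and Cor. 1.9] -/
theorem exists_isometryEquiv_normalForm [B.IsPerfPair] (h : TwoHyperbolicPairs B x y x₁ y₁)
    (hev : B.IsEven) {p q : W} (hpp : B p p = 0) (hqq : B q q = 0) (hpq : B p q = 1)
    (hpx : B p x = 0) (hpy : B p y = 0) (hqx : B q x = 0) (hqy : B q y = 0) (hpx₁ : B p x₁ = 0)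
    (hpy₁ : B p y₁ = 0) (hqx₁ : B q x₁ = 0) (hqy₁ : B q y₁ = 0) {a b c : ℤ}
    (hdisc : b * b < 4 * a * c) {t₁ t₂ : W} (h11 : B t₁ t₁ = 2 * a) (h12 : B t₁ t₂ = b)
    (h22 : B t₂ t₂ = 2 * c)
    (hprim : ∀ (v : W) (n : ℤ), n ≠ 0 → (∃ m₁ m₂ : ℤ, n • v = m₁ • t₁ + m₂ • t₂) →
      ∃ m₁ m₂ : ℤ, v = m₁ • t₁ + m₂ • t₂) :
    ∃ Φ : B.IsometryEquiv B, Φ t₁ = p + a • q ∧ Φ t₂ = b • q + x₁ + c • y₁ := by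
  have hB := h.isSymm
  have h21 : B t₂ t₁ = b := by rw [hB.eq, h12]
  obtain ⟨s₁, s₂, hs₁, hs₂₁, hs₂₂⟩ :=
    exists_dual_witnesses (B := B) (eq_zero_of_gram h11 h12 h21 h22 hdisc) hprim
  -- step 1: `t₁ ↦ p + a q`
  obtain ⟨l₁, hl₁, ht₁⟩ :=
    exists_uGens_apply_eq_normalForm₁ h hev hpp hqq hpq hpx hpy hqx hqy a h11 hs₁
  set Φ₁ := UGen.evalEquiv hB h.xx h.yy l₁ hl₁ with hΦ₁E
  have hΦ₁t₁ : Φ₁ t₁ = p + a • q := by rw [hΦ₁E, UGen.evalEquiv_apply]; exact ht₁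
  -- step 2: `t₂ ↦ b q + x₁ + c y₁`, fixing `p + a q`
  have hct : B (p + a • q) (Φ₁ t₂) = b := by rw [← hΦ₁t₁, Φ₁.map_app]; exact h12
  have htt : B (Φ₁ t₂) (Φ₁ t₂) = 2 * c := by rw [Φ₁.map_app]; exact h22
  have hcs : B (p + a • q) (Φ₁ s₂) = 0 := by rw [← hΦ₁t₁, Φ₁.map_app]; exact hs₂₁
  have hts : B (Φ₁ t₂) (Φ₁ s₂) = 1 := by rw [Φ₁.map_app]; exact hs₂₂
  obtain ⟨l₂, hl₂, hc₁, ht₂⟩ := exists_uGens_apply_eq_normalForm₂ h hev hqq hpq hpx hpy hqx hqy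
    hpx₁ hpy₁ hqx₁ hqy₁ a b c hct htt hcs hts
  refine ⟨Φ₁.trans (UGen.evalEquiv hB h.xx h.yy l₂ hl₂), ?_, ?_⟩
  · rw [LinearMap.BilinForm.IsometryEquiv.trans_apply, hΦ₁t₁, UGen.evalEquiv_apply]; exact hc₁
  · rw [LinearMap.BilinForm.IsometryEquiv.trans_apply, UGen.evalEquiv_apply]; exact ht₂

end Abstract

/-! ### The K3 lattice `Λ = E₈(−1)^{⊕2} ⊕ ⟨p, q⟩ ⊕ ⟨x, y⟩ ⊕ ⟨x₁, y₁⟩` -/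
section K3

/-- The three hyperbolic planes `U₁ ⊕ U₂ ⊕ U₃ ⊂ Λ_{K3}` (Huybrechts Ch. 14 §0.3 (vi)): their
standard bases are a hyperbolic pair `(p, q)` orthogonal to two orthogonal hyperbolic pairs
`(x, y)`, `(x₁, y₁)` of the symmetric form `k3Gram`. [cite: Huybrechts2016K3, Ch. 14 §0.3 (vi)] -/
theorem exists_hyperbolicPairs_k3 : ∃ p q x y x₁ y₁ : K3Index → ℤ,
    TwoHyperbolicPairs (Matrix.toBilin' k3Gram) x y x₁ y₁ ∧ Matrix.toBilin' k3Gram p p = 0 ∧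
      Matrix.toBilin' k3Gram q q = 0 ∧ Matrix.toBilin' k3Gram p q = 1 ∧
      Matrix.toBilin' k3Gram p x = 0 ∧ Matrix.toBilin' k3Gram p y = 0 ∧
      Matrix.toBilin' k3Gram q x = 0 ∧ Matrix.toBilin' k3Gram q y = 0 ∧
      Matrix.toBilin' k3Gram p x₁ = 0 ∧ Matrix.toBilin' k3Gram p y₁ = 0 ∧
      Matrix.toBilin' k3Gram q x₁ = 0 ∧ Matrix.toBilin' k3Gram q y₁ = 0 := by
  refine ⟨Pi.single (Sum.inr (Sum.inl 0)) 1, Pi.single (Sum.inr (Sum.inl 1)) 1,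
    Pi.single (Sum.inr (Sum.inr (Sum.inl 0))) 1, Pi.single (Sum.inr (Sum.inr (Sum.inl 1))) 1,
    Pi.single (Sum.inr (Sum.inr (Sum.inr 0))) 1, Pi.single (Sum.inr (Sum.inr (Sum.inr 1))) 1,
    ⟨isSymm_toBilin'_k3Gram, ?_, ?_, ?_, ?_, ?_, ?_, ?_, ?_, ?_, ?_⟩,
    ?_, ?_, ?_, ?_, ?_, ?_, ?_, ?_, ?_, ?_, ?_⟩ <;>
  (rw [Matrix.toBilin'_single]; rfl)

/-- **Discharge of `Nikulin1980_k3Lattice_primitiveEmbedding_rankTwo_unique`** (Huybrechts Ch. 14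
Cor. 1.9, "unique up to automorphisms of `Λ`" for rank `2 < 3`, after James 1968; Nikulin
Thm. 1.14.4): `Λ_{K3}` is symmetric, even and unimodular with three hyperbolic planes, so both
pairs are moved to the normal form of `exists_isometryEquiv_normalForm`, and the composite
isometry `Φ⁻¹ ∘ Φ'` is the required `g ∈ O(Λ_{K3})` (`gᵀ Λ g = Λ`, `g t' = t`).
[cite: Huybrechts2016K3, Ch. 14 Cor. 1.9 and Thm. 1.12] [cite: Nikulin1980, Thm. 1.14.4] -/
theorem Nikulin1980_k3Lattice_primitiveEmbedding_rankTwo_unique_holds :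
    Nikulin1980_k3Lattice_primitiveEmbedding_rankTwo_unique := by
  intro a b c _ _ hdisc t₁ t₂ t₁' t₂' h11 h12 h22 hprim h11' h12' h22' hprim'
  simp only [← Matrix.toBilin'_apply] at h11 h12 h22 h11' h12' h22'
  haveI : (Matrix.toBilin' k3Gram).IsPerfPair := isUnimodular_toBilin'_k3Gram
  obtain ⟨p, q, x, y, x₁, y₁, hk, hpp, hqq, hpq, hpx, hpy, hqx, hqy, hpx₁, hpy₁, hqx₁, hqy₁⟩ :=
    exists_hyperbolicPairs_k3
  obtain ⟨Φ, hΦ₁, hΦ₂⟩ := exists_isometryEquiv_normalForm hk isEven_toBilin'_k3Gram hpp hqq hpq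
    hpx hpy hqx hqy hpx₁ hpy₁ hqx₁ hqy₁ hdisc h11 h12 h22 hprim
  obtain ⟨Φ', hΦ₁', hΦ₂'⟩ := exists_isometryEquiv_normalForm hk isEven_toBilin'_k3Gram hpp hqq hpq
    hpx hpy hqx hqy hpx₁ hpy₁ hqx₁ hqy₁ hdisc h11' h12' h22' hprim'
  set Ψ := Φ'.trans Φ.symm with hΨE
  have hΨ₁ : Ψ t₁' = t₁ := by
    rw [hΨE, LinearMap.BilinForm.IsometryEquiv.trans_apply, hΦ₁', ← hΦ₁]
    exact Φ.toLinearEquiv.symm_apply_apply t₁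
  have hΨ₂ : Ψ t₂' = t₂ := by
    rw [hΨE, LinearMap.BilinForm.IsometryEquiv.trans_apply, hΦ₂', ← hΦ₂]
    exact Φ.toLinearEquiv.symm_apply_apply t₂
  set ψ : (K3Index → ℤ) →ₗ[ℤ] (K3Index → ℤ) := Ψ.toLinearEquiv.toLinearMap with hψE
  have hψ : ∀ v, ψ v = Ψ v := fun v => rfl
  refine ⟨LinearMap.toMatrix' ψ, ?_, ?_, ?_⟩
  · have key := LinearMap.BilinForm.toMatrix'_comp (Matrix.toBilin' k3Gram) ψ ψ
    have hcomp : (Matrix.toBilin' k3Gram).comp ψ ψ = Matrix.toBilin' k3Gram := by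
      refine LinearMap.ext fun v => LinearMap.ext fun w => ?_
      rw [LinearMap.BilinForm.comp_apply, hψ, hψ]
      exact Ψ.map_app w v
    rw [hcomp, LinearMap.BilinForm.toMatrix'_toBilin'] at key
    exact key.symm
  · rw [LinearMap.toMatrix'_mulVec, hψ, hΨ₁]
  · rw [LinearMap.toMatrix'_mulVec, hψ, hΨ₂]

end K3

end Literature.AlgebraicGeometry.Surfaces

end
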